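import Summits.CriticalPhenomena.SAWScalingLimit.Theses.SAWTwistedSelfEnergy
import HarnessLib

/-!
# `stub_udr` is FALSE as typed: `¬ UniformDeadEndRestriction` (line `Sketch` = R2K4, crux stmt-CriticalPhenomena-1881)

Lead a1 (prover-line-stmt-CriticalPhenomena-1881-a1-0), 2026-08-17.  `lean check` target: rc 0, sorries 0.

The definitions `LatPath`, `mass`, `CutFrom`, `pocket`, `UDR`, `UniformDeadEndRestriction` below are copied
VERBATIM from the ideator's sketch `Cruxes/EventualTight/SketchIdeatorR2K4.lean` (namespace `…IdeatorR2K4`) and from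
the registered skeleton `Lines/SketchR2K4_1881.lean` (namespace `…LineSketchR2K4`, same names), so that
`not_uniformDeadEndRestriction` is literally the negation of the registered stub `stub_udr`.

WITNESS (inward clause of `UDR C q n₁`, any `C`, any `q < 1`, any `n₁`): `Λ` = the lattice segment
`{(j,0) : |j| ≤ L}`, `c = (-L,0)`, `b = (L,0)`, mouth `K = {c, b}`, centre `z₀ = 0`, `r = max n₁ 1`,
`L = ⌈|C| r⌉₊ + 1`.  Because `c, b ∈ K`, `CutFrom Λ K c v` and `CutFrom Λ K b v` hold for EVERY `v` (the end-vertex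
of any walk to `c` is `c ∈ K`), so the typed `pocket Λ K c b` is all of `Λ ∖ K`; the mouth lies at distance
`L ≥ C r` from `z₀`, and the clause demands that deleting the pocket vertices within `r` of `z₀` (among them the
origin) keeps the fraction `1 - q > 0` of the mass `Z_Λ(c,b) ≥ x_c^{2L} > 0` — but it disconnects `c` from `b`
(every lattice walk from abscissa `-L` to `+L` passes abscissa `0`, and the only vertex of `Λ` there is the
origin), so the right-hand side is `0`.  The same two-piece-mouth mechanism with `c, b ∉ K` (mouth = the two
inner neighbours `(∓(L-1),0)`) is `not_udr'` below: the typed `pocket` lets a THROUGH-corridor count as a dead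
end whenever the mouth has one piece on each side.  Repair R1 of the dead-line file (pockets := the connected
components of `Λ ∖ K` containing neither `c` nor `b`, `pocketC`) is refuted by the same witness: `not_udr₁'`.
-/

noncomputable section

open MeasureTheory Filter Topology Set Metric
open scoped ENNReal NNReal
open Literature.Probability.RandomPlanarGeometry Literature.Probability.LatticeModels

namespace Summit.CriticalPhenomena.SAWScalingLimit.Cruxes.EventualTight.LineSketchR2K4

/-! ## The atom, verbatim -/

/-- Self-avoiding lattice paths `c → b` of `ℤ²` with all vertices in `Λ`. -/
def LatPath (Λ : Set (Site 2)) (c b : Site 2) : Type :=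
  {p : (zdGraph 2).Walk c b // p.IsPath ∧ ∀ v ∈ p.support, v ∈ Λ}

/-- `x_c`-mass `Z_Λ(c,b) = Σ_{SAW c→b in Λ} x_c^{|ω|}` (an `ℝ≥0∞`-valued `tsum`; finite for finite `Λ`). -/
def mass (Λ : Set (Site 2)) (c b : Site 2) : ENNReal :=
  ∑' p : LatPath Λ c b, ENNReal.ofReal (SAW.criticalFugacity ^ p.1.length)

/-- `v` is cut from `x` by the mouth `K` inside `Λ`: every `Λ`-path from `v` to `x` meets `K`
(if `x ∈ K` this holds trivially). -/
def CutFrom (Λ K : Set (Site 2)) (x v : Site 2) : Prop :=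
  ∀ p : (zdGraph 2).Walk v x, (∀ w ∈ p.support, w ∈ Λ) → ∃ w ∈ p.support, w ∈ K

/-- The DEAD-END POCKET behind the mouth `K`: vertices of `Λ ∖ K` cut from BOTH endpoints by `K`. -/
def pocket (Λ K : Set (Site 2)) (c b : Site 2) : Set (Site 2) :=
  {v | v ∈ Λ ∧ v ∉ K ∧ CutFrom Λ K c v ∧ CutFrom Λ K b v}

/-- **UDR C q n₁ — Uniform Dead-end Restriction bound** for the critical `ℤ²` SAW (the atom of the card,
verbatim). -/
def UDR (C q : ℝ) (n₁ : ℕ) : Prop :=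
  ∀ (Λ K : Set (Site 2)) (c b : Site 2) (z₀ : ℂ) (r : ℝ), Λ.Finite → K ⊆ Λ → (n₁ : ℝ) ≤ r →
    ((∀ v ∈ K, dist (Site.toComplex v) z₀ ≤ r) →
      ENNReal.ofReal (1 - q) * mass Λ c b ≤
        mass (Λ \ {v | v ∈ pocket Λ K c b ∧ C * r ≤ dist (Site.toComplex v) z₀}) c b) ∧
    ((∀ v ∈ K, C * r ≤ dist (Site.toComplex v) z₀) →
      ENNReal.ofReal (1 - q) * mass Λ c b ≤
        mass (Λ \ {v | v ∈ pocket Λ K c b ∧ dist (Site.toComplex v) z₀ ≤ r}) c b)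

/-- The atom of the line, existentially packaged (`∃ C q n₁`). -/
def UniformDeadEndRestriction : Prop :=
  ∃ C q : ℝ, ∃ n₁ : ℕ, 1 < C ∧ q < 1 ∧ UDR C q n₁

/-! ## Lattice bookkeeping: one step moves a coordinate by at most one; discrete intermediate values -/

/-- A nearest-neighbour step of `ℤ²` changes each coordinate by at most `1`. [folklore] -/
theorem adj_apply_le {x y : Site 2} (h : (zdGraph 2).Adj x y) (i : Fin 2) :
    y i ≤ x i + 1 ∧ x i ≤ y i + 1 := by
  obtain ⟨j, rfl | rfl⟩ := (zdGraph_adj_iff x y).1 h <;> by_cases hij : i = j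
  · subst hij; exact ⟨by simp, by simp; omega⟩
  · refine ⟨?_, ?_⟩ <;> simp [hij]
  · subst hij; exact ⟨by simp; omega, by simp⟩
  · refine ⟨?_, ?_⟩ <;> simp [hij]

/-- Discrete intermediate value property: a lattice walk whose `i`-th coordinate starts `≤ m` and ends `≥ m`
visits a vertex with `i`-th coordinate exactly `m`. [folklore] -/
theorem exists_mem_support_apply_eq {u v : Site 2} (p : (zdGraph 2).Walk u v) (i : Fin 2) (m : ℤ)
    (hu : u i ≤ m) (hv : m ≤ v i) : ∃ w ∈ p.support, w i = m := by
  induction p with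
  | nil => exact ⟨_, SimpleGraph.Walk.start_mem_support _, le_antisymm hu hv⟩
  | @cons x y z h q ih =>
    by_cases hx : x i = m
    · exact ⟨x, by simp, hx⟩
    · have hlt : x i < m := lt_of_le_of_ne hu hx
      have hy : y i ≤ m := by have := (adj_apply_le h i).1; omega
      obtain ⟨w, hw, hwm⟩ := ih hy hv
      exact ⟨w, by simp [hw], hwm⟩

/-- The straight lattice segment from `(a, 0)` to `(a + n, 0)` is a self-avoiding walk of length `n` whose
vertices are the `(j, 0)`, `a ≤ j ≤ a + n`. [folklore] -/
theorem exists_linePath (n : ℕ) : ∀ a : ℤ, ∃ p : (zdGraph 2).Walk (![a, 0] : Site 2) ![a + n, 0],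
    p.IsPath ∧ p.length = n ∧ ∀ w ∈ p.support, w 1 = 0 ∧ a ≤ w 0 ∧ w 0 ≤ a + n := by
  induction n with
  | zero =>
    intro a
    refine ⟨(SimpleGraph.Walk.nil : (zdGraph 2).Walk (![a, 0] : Site 2) ![a, 0]).copy rfl (by simp),
      by simp, by simp, ?_⟩
    intro w hw
    simp only [SimpleGraph.Walk.support_copy, SimpleGraph.Walk.support_nil, List.mem_singleton] at hw
    subst hw
    simp
  | succ n ih =>
    intro a
    obtain ⟨p, hp, hlen, hsupp⟩ := ih (a + 1)
    have hadj : (zdGraph 2).Adj (![a, 0] : Site 2) ![a + 1, 0] := by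
      rw [zdGraph_adj_iff]
      refine ⟨0, Or.inl ?_⟩
      funext i
      fin_cases i <;> simp
    have hend : (![a + 1 + (n : ℤ), 0] : Site 2) = ![a + ((n + 1 : ℕ) : ℤ), 0] := by
      push_cast
      ring_nf
    refine ⟨(SimpleGraph.Walk.cons hadj p).copy rfl hend, ?_, ?_, ?_⟩
    · rw [SimpleGraph.Walk.isPath_copy]
      refine hp.cons ?_
      intro hmem
      have := (hsupp _ hmem).2.1
      simp at this
    · simp [hlen]
    · intro w hw
      simp only [SimpleGraph.Walk.support_copy, SimpleGraph.Walk.support_cons, List.mem_cons] at hw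
      rcases hw with rfl | hw
      · simp only [Matrix.cons_val_one, Matrix.cons_val_zero, le_refl, true_and]
        push_cast
        omega
      · obtain ⟨h1, h2, h3⟩ := hsupp w hw
        refine ⟨h1, by omega, ?_⟩
        push_cast
        omega

/-- The complex coordinate of the lattice point `(j, 0)` is the real number `j`. [folklore] -/
theorem toComplex_axis (j : ℤ) : Site.toComplex (![j, 0] : Site 2) = ((j : ℝ) : ℂ) := by
  apply Complex.ext <;> simp [Site.toComplex]

/-- Distance from `(j, 0)` to the origin is `|j|`. [folklore] -/
theorem dist_toComplex_axis_zero (j : ℤ) : dist (Site.toComplex (![j, 0] : Site 2)) 0 = |(j : ℝ)| := by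
  rw [toComplex_axis, dist_zero_right, Complex.norm_real, Real.norm_eq_abs]

/-! ## The witness domain: the lattice segment `{(j,0) : |j| ≤ L}` -/

/-- The lattice segment `Λ_L = {(j, 0) : -L ≤ j ≤ L}`. -/
def seg (L : ℕ) : Set (Site 2) := {w | w 1 = 0 ∧ -(L : ℤ) ≤ w 0 ∧ w 0 ≤ L}

/-- Its left end `c = (-L, 0)`. -/
def cL (L : ℕ) : Site 2 := ![-(L : ℤ), 0]

/-- Its right end `b = (L, 0)`. -/
def bL (L : ℕ) : Site 2 := ![(L : ℤ), 0]

theorem cL_mem_seg (L : ℕ) : cL L ∈ seg L := by simp [seg, cL]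

theorem bL_mem_seg (L : ℕ) : bL L ∈ seg L := by simp [seg, bL]

/-- The segment is finite. [folklore] -/
theorem seg_finite (L : ℕ) : (seg L).Finite := by
  refine ((Set.finite_Icc (-(L : ℤ)) L).image fun j : ℤ => (![j, 0] : Site 2)).subset ?_
  intro w hw
  obtain ⟨h1, h2, h3⟩ := hw
  refine ⟨w 0, ⟨h2, h3⟩, ?_⟩
  funext i
  fin_cases i <;> simp [h1]
/-- A vertex of the segment with abscissa `m` is `(m, 0)`. [folklore] -/
theorem eq_of_mem_seg {L : ℕ} {w : Site 2} (hw : w ∈ seg L) {m : ℤ} (hm : w 0 = m) :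
    w = ![m, 0] := by
  obtain ⟨h1, -, -⟩ := hw
  funext i
  fin_cases i <;> simp [hm, h1]

/-- `x_c > 0` (from `μ(ℤ²) > 0`, in tree). [cite: MadrasSlade1993, §1.2] -/
theorem criticalFugacity_pos'' : 0 < SAW.criticalFugacity := by
  have hμ := SAW.Zd.connectiveConstant_pos 2
  rw [SAW.Zd.connectiveConstant_two] at hμ
  exact inv_pos.2 hμ

/-- The straight walk is a SAW from `c` to `b` inside the segment, so `Z_{Λ_L}(c,b) > 0`. [folklore] -/
theorem mass_seg_pos (L : ℕ) : 0 < mass (seg L) (cL L) (bL L) := by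
  obtain ⟨p, hp, -, hsupp⟩ := exists_linePath (2 * L) (-(L : ℤ))
  have hend : (![-(L : ℤ) + ((2 * L : ℕ) : ℤ), 0] : Site 2) = bL L := by
    rw [bL]; push_cast; ring_nf
  let P : LatPath (seg L) (cL L) (bL L) := ⟨p.copy rfl hend, by rwa [SimpleGraph.Walk.isPath_copy], by
    intro v hv
    rw [SimpleGraph.Walk.support_copy] at hv
    obtain ⟨h1, h2, h3⟩ := hsupp v hv
    exact ⟨h1, h2, by push_cast at h3; omega⟩⟩
  have hle : ENNReal.ofReal (SAW.criticalFugacity ^ P.1.length) ≤ mass (seg L) (cL L) (bL L) :=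
    ENNReal.le_tsum P
  exact lt_of_lt_of_le (ENNReal.ofReal_pos.2 (pow_pos criticalFugacity_pos'' _)) hle

/-- Deleting any set containing the origin disconnects `c` from `b` in the segment: the restricted mass is `0`
(every lattice walk from abscissa `-L` to `L` visits abscissa `0`). [folklore] -/
theorem mass_seg_diff_eq_zero {L : ℕ} {R : Set (Site 2)} (h0 : (![0, 0] : Site 2) ∈ R) :
    mass (seg L \ R) (cL L) (bL L) = 0 := by
  have hempty : IsEmpty (LatPath (seg L \ R) (cL L) (bL L)) := by
    refine ⟨fun p => ?_⟩
    obtain ⟨w, hw, hw0⟩ := exists_mem_support_apply_eq p.1 0 0 (by simp [cL]) (by simp [bL])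
    obtain ⟨hwΛ, hwR⟩ := p.2.2 w hw
    exact hwR (by rwa [eq_of_mem_seg hwΛ hw0])
  rw [mass]
  exact tsum_empty

/-- The shape of the contradiction: `(1 - q) · Z_Λ(c,b) ≤ Z_{Λ∖R}(c,b)` is impossible when `q < 1` and the
origin is deleted. [folklore] -/
theorem false_of_key {q : ℝ} (hq : q < 1) {L : ℕ} {R : Set (Site 2)} (h0 : (![0, 0] : Site 2) ∈ R)
    (key : ENNReal.ofReal (1 - q) * mass (seg L) (cL L) (bL L) ≤ mass (seg L \ R) (cL L) (bL L)) :
    False := by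
  rw [mass_seg_diff_eq_zero h0] at key
  rcases mul_eq_zero.1 (le_zero_iff.1 key) with h | h
  · rw [ENNReal.ofReal_eq_zero] at h; linarith
  · exact (mass_seg_pos L).ne' h

/-- Distances of the axis points `(±j, 0)` from the origin. [folklore] -/
theorem dist_cL (L : ℕ) : dist (Site.toComplex (cL L)) 0 = L := by
  rw [cL, dist_toComplex_axis_zero]; push_cast; rw [abs_neg, Nat.abs_cast]

theorem dist_bL (L : ℕ) : dist (Site.toComplex (bL L)) 0 = L := by
  rw [bL, dist_toComplex_axis_zero]; push_cast; rw [Nat.abs_cast]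

/-! ## The refutation -/

/-- **`UDR C q n₁` is false for every `C`, every `q < 1` and every `n₁`** — degenerate two-piece mouth
`K = {c, b}`: then `CutFrom Λ K c ·` and `CutFrom Λ K b ·` hold for every vertex, the typed pocket is `Λ ∖ K`,
and the inward clause (mouth at distance `L ≥ C r` from `z₀ = 0`) deletes the origin. [folklore] -/
theorem not_udr (C q : ℝ) (n₁ : ℕ) (hq : q < 1) : ¬ UDR C q n₁ := by
  intro h
  set r : ℝ := max (n₁ : ℝ) 1 with hr
  have hr1 : 1 ≤ r := le_max_right _ _
  set L : ℕ := ⌈|C| * r⌉₊ + 1 with hL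
  have hCr : C * r ≤ (L : ℝ) := by
    have h1 : C * r ≤ |C| * r := mul_le_mul_of_nonneg_right (le_abs_self C) (by linarith)
    have h2 : |C| * r ≤ (⌈|C| * r⌉₊ : ℝ) := Nat.le_ceil _
    have h3 : ((⌈|C| * r⌉₊ : ℕ) : ℝ) ≤ (L : ℝ) := by rw [hL]; push_cast; linarith
    linarith
  have hL1 : 1 ≤ L := by rw [hL]; omega
  set K : Set (Site 2) := {cL L, bL L} with hK
  have hKΛ : K ⊆ seg L := by
    rintro v (rfl | rfl)
    · exact cL_mem_seg L
    · exact bL_mem_seg L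
  have hfar : ∀ v ∈ K, C * r ≤ dist (Site.toComplex v) 0 := by
    rintro v (rfl | rfl)
    · rw [dist_cL]; exact hCr
    · rw [dist_bL]; exact hCr
  have key := (h (seg L) K (cL L) (bL L) 0 r (seg_finite L) hKΛ (le_max_left _ _)).2 hfar
  refine false_of_key hq ?_ key
  -- the origin is a deleted pocket vertex
  refine ⟨⟨by simp [seg], ?_, ?_, ?_⟩, ?_⟩
  · rintro (h0 | h0)
    · have := congrFun h0 0; simp only [cL, Matrix.cons_val_zero] at this; omega
    · have := congrFun h0 0; simp only [bL, Matrix.cons_val_zero] at this; omega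
  · intro p _; exact ⟨cL L, p.end_mem_support, by simp [hK]⟩
  · intro p _; exact ⟨bL L, p.end_mem_support, by simp [hK]⟩
  · have h0 : Site.toComplex (![0, 0] : Site 2) = 0 := by
      apply Complex.ext <;> simp [Site.toComplex]
    rw [h0, dist_self]
    linarith

/-- **The same with the endpoints OFF the mouth** (`1 < C`): mouth `K = {(-(L-1),0), (L-1,0)}`, the two inner
neighbours of `c, b`; the origin is again a typed pocket vertex (every segment walk from the origin to `c` passes
abscissa `-(L-1)`, to `b` passes `L-1`), although the region behind this two-piece mouth is a THROUGH-corridor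
between `c` and `b`, not a dead end. [folklore] -/
theorem not_udr' (C q : ℝ) (n₁ : ℕ) (hC : 1 < C) (hq : q < 1) : ¬ UDR C q n₁ := by
  intro h
  set r : ℝ := max (n₁ : ℝ) 1 with hr
  have hr1 : 1 ≤ r := le_max_right _ _
  set M : ℕ := ⌈C * r⌉₊ with hM
  have hCr : C * r ≤ (M : ℝ) := Nat.le_ceil _
  have hM1 : 1 ≤ M := by
    have : (0 : ℝ) < C * r := by nlinarith
    have : 0 < M := Nat.ceil_pos.2 this
    omega
  set L : ℕ := M + 1 with hL
  -- the mouth: the inner neighbours `(∓M, 0)` of `c = (-L,0)`, `b = (L,0)`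
  set K : Set (Site 2) := {cL M, bL M} with hK
  have hKΛ : K ⊆ seg L := by
    rintro v (rfl | rfl)
    · refine ⟨by simp [cL], ?_, ?_⟩ <;> simp only [cL, hL, Matrix.cons_val_zero] <;> push_cast <;> omega
    · refine ⟨by simp [bL], ?_, ?_⟩ <;> simp only [bL, hL, Matrix.cons_val_zero] <;> push_cast <;> omega
  have hfar : ∀ v ∈ K, C * r ≤ dist (Site.toComplex v) 0 := by
    rintro v (rfl | rfl)
    · rw [dist_cL]; exact hCr
    · rw [dist_bL]; exact hCr
  have key := (h (seg L) K (cL L) (bL L) 0 r (seg_finite L) hKΛ (le_max_left _ _)).2 hfar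
  refine false_of_key hq ?_ key
  refine ⟨⟨by simp [seg], ?_, ?_, ?_⟩, ?_⟩
  · rintro (h0 | h0)
    · have := congrFun h0 0; simp only [cL, Matrix.cons_val_zero] at this; omega
    · have := congrFun h0 0; simp only [bL, Matrix.cons_val_zero] at this; omega
  · -- every segment walk from the origin to `c = (-L,0)` passes `(-M, 0) ∈ K`
    intro p hp
    obtain ⟨w, hw, hw0⟩ := exists_mem_support_apply_eq p.reverse 0 (-(M : ℤ))
      (by simp [cL, hL]) (by simp)
    rw [SimpleGraph.Walk.support_reverse, List.mem_reverse] at hw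
    refine ⟨w, hw, Or.inl ?_⟩
    rw [eq_of_mem_seg (hp w hw) hw0, cL]
  · -- every segment walk from the origin to `b = (L,0)` passes `(M, 0) ∈ K`
    intro p hp
    obtain ⟨w, hw, hw0⟩ := exists_mem_support_apply_eq p 0 (M : ℤ) (by simp) (by simp [bL, hL])
    refine ⟨w, hw, Or.inr ?_⟩
    rw [eq_of_mem_seg (hp w hw) hw0, bL, Set.mem_singleton_iff]
  · have h0 : Site.toComplex (![0, 0] : Site 2) = 0 := by
      apply Complex.ext <;> simp [Site.toComplex]
    rw [h0, dist_self]
    linarith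

/-! ## Repair R1 (component pockets) is refuted by the same witness -/

/-- `x` and `y` are joined by a lattice walk all of whose vertices lie in `S`. -/
def JoinedIn (S : Set (Site 2)) (x y : Site 2) : Prop :=
  ∃ p : (zdGraph 2).Walk x y, ∀ w ∈ p.support, w ∈ S

/-- **Component pocket** (repair R1 of the dead-line file): the vertices of `Λ ∖ K` joined inside `Λ ∖ K` neither to
`c` nor to `b` — the union of the connected components of `Λ ∖ K` containing neither endpoint. -/
def pocketC (Λ K : Set (Site 2)) (c b : Site 2) : Set (Site 2) :=
  {v | v ∈ Λ ∧ v ∉ K ∧ ¬ JoinedIn (Λ \ K) v c ∧ ¬ JoinedIn (Λ \ K) v b}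

/-- `UDR` with the component pocket in place of the `CutFrom` pocket (repair R1). -/
def UDR₁ (C q : ℝ) (n₁ : ℕ) : Prop :=
  ∀ (Λ K : Set (Site 2)) (c b : Site 2) (z₀ : ℂ) (r : ℝ), Λ.Finite → K ⊆ Λ → (n₁ : ℝ) ≤ r →
    ((∀ v ∈ K, dist (Site.toComplex v) z₀ ≤ r) →
      ENNReal.ofReal (1 - q) * mass Λ c b ≤
        mass (Λ \ {v | v ∈ pocketC Λ K c b ∧ C * r ≤ dist (Site.toComplex v) z₀}) c b) ∧
    ((∀ v ∈ K, C * r ≤ dist (Site.toComplex v) z₀) →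
      ENNReal.ofReal (1 - q) * mass Λ c b ≤
        mass (Λ \ {v | v ∈ pocketC Λ K c b ∧ dist (Site.toComplex v) z₀ ≤ r}) c b)

/-- **Repair R1 is false too** (`1 < C`, `q < 1`): in the witness of `not_udr'` the middle segment
`{(j,0) : |j| < M}` is a connected component of `Λ ∖ K` containing neither `c` nor `b` (every walk from the origin to `c`
inside `Λ` passes the mouth vertex `(-M,0) ∈ K`, to `b` passes `(M,0) ∈ K`), so the origin lies in the COMPONENT pocket as
well, and the inward clause again deletes it. [folklore] -/
theorem not_udr₁' (C q : ℝ) (n₁ : ℕ) (hC : 1 < C) (hq : q < 1) : ¬ UDR₁ C q n₁ := by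
  intro h
  set r : ℝ := max (n₁ : ℝ) 1 with hr
  have hr1 : 1 ≤ r := le_max_right _ _
  set M : ℕ := ⌈C * r⌉₊ with hM
  have hCr : C * r ≤ (M : ℝ) := Nat.le_ceil _
  have hM1 : 1 ≤ M := by
    have : (0 : ℝ) < C * r := by nlinarith
    have : 0 < M := Nat.ceil_pos.2 this
    omega
  set L : ℕ := M + 1 with hL
  set K : Set (Site 2) := {cL M, bL M} with hK
  have hKΛ : K ⊆ seg L := by
    rintro v (rfl | rfl)
    · refine ⟨by simp [cL], ?_, ?_⟩ <;> simp only [cL, hL, Matrix.cons_val_zero] <;> push_cast <;> omega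
    · refine ⟨by simp [bL], ?_, ?_⟩ <;> simp only [bL, hL, Matrix.cons_val_zero] <;> push_cast <;> omega
  have hfar : ∀ v ∈ K, C * r ≤ dist (Site.toComplex v) 0 := by
    rintro v (rfl | rfl)
    · rw [dist_cL]; exact hCr
    · rw [dist_bL]; exact hCr
  have key := (h (seg L) K (cL L) (bL L) 0 r (seg_finite L) hKΛ (le_max_left _ _)).2 hfar
  refine false_of_key hq ?_ key
  refine ⟨⟨by simp [seg], ?_, ?_, ?_⟩, ?_⟩
  · rintro (h0 | h0)
    · have := congrFun h0 0; simp only [cL, Matrix.cons_val_zero] at this; omega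
    · have := congrFun h0 0; simp only [bL, Matrix.cons_val_zero] at this; omega
  · -- not joined to `c` inside `Λ ∖ K`: the walk passes `(-M, 0) ∈ K`
    rintro ⟨p, hp⟩
    obtain ⟨w, hw, hw0⟩ := exists_mem_support_apply_eq p.reverse 0 (-(M : ℤ))
      (by simp [cL, hL]) (by simp)
    rw [SimpleGraph.Walk.support_reverse, List.mem_reverse] at hw
    obtain ⟨hwΛ, hwK⟩ := hp w hw
    exact hwK (Or.inl (by rw [eq_of_mem_seg hwΛ hw0, cL]))
  · -- not joined to `b` inside `Λ ∖ K`: the walk passes `(M, 0) ∈ K`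
    rintro ⟨p, hp⟩
    obtain ⟨w, hw, hw0⟩ := exists_mem_support_apply_eq p 0 (M : ℤ) (by simp) (by simp [bL, hL])
    obtain ⟨hwΛ, hwK⟩ := hp w hw
    exact hwK (Or.inr (by rw [eq_of_mem_seg hwΛ hw0, bL, Set.mem_singleton_iff]))
  · have h0 : Site.toComplex (![0, 0] : Site 2) = 0 := by
      apply Complex.ext <;> simp [Site.toComplex]
    rw [h0, dist_self]
    linarith

/-- **The atom of line `Sketch` (R2K4) is false**: `¬ UniformDeadEndRestriction` (= `¬ stub_udr`). -/
theorem not_uniformDeadEndRestriction : ¬ UniformDeadEndRestriction := by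
  rintro ⟨C, q, n₁, -, hq, h⟩
  exact not_udr C q n₁ hq h

end Summit.CriticalPhenomena.SAWScalingLimit.Cruxes.EventualTight.LineSketchR2K4

end
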